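import Summits.QuantumFields.BalabanUV.T4Continuum.Support.NE7BlockDefectSymbolBound
import Literature.MathematicalPhysics.QuantumFieldTheory.Balaban1983to89.T4AveragingDeficit

/-!
# NE7BlockDefectSymbolStencil — H-1′: the K2a abelian symbol lemma meets the TREE'S TYPED block average.  On every plane
# wave of the typed fine torus, Federbush's one-step action DEFICIT of Bałaban's linear average `Q_k` (B5 (1.18) =
# `B5Block118.QvOp`; deficit = `T4AveragingDeficit.deficit`) IS, plane by plane and exactly, the closed-form defect of
# parts 1–2 (`NE7BlockDefectSymbol`, `NE7BlockDefectSymbolBound`); hence it is FOURTH ORDER in the fine angles with the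
# SHARP constant `(n²−1)∕12` — a kernel statement about the tree's typed operator BY NAME

Cell `pub-balaban`, rung (B)+1 sub-cell t4, lineage `b2b-balaban-t4-ne7-p2` (CRUX PROVER NE7 #2 under the coordinator
ruling «YM redirect», 2026-08-21; generation 50; texts `HOME/t4/b2b-balaban-t4-ne7-p2/g50/HOM-JUNCTION-NE7-P2.md` v2 §2,
`g50/ROUTE2-NE7-P2.md` v1.5).  HONEST FRAMING (page 1): FIXED FINITE T⁴, rung (B)+1 = existence AND uniqueness of the
`ε = L^{−K} → 0` limit of unit-scale averaged expectations, CONDITIONAL on BetaPertH and the nine spine estimates (0/9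
proved); NOT infinite volume, NOT a mass gap, NOT the Clay problem.  NE7 is NOT PRINTED in [Balaban1984PropagatorsI]–
[Balaban1989LargeFieldII] and NOT proved here.  Everything below is [folklore] (characters of a finite torus, geometric
sums, finite-sum algebra) about the TREE'S OWN typed definitions; no cite tag is a hypothesis, nothing printed is asserted,
no `sorry`.

WHY (what parts 1–2 left open, and what this file closes).  Parts 1–2 proved, for the CLOSED FORM of balaban-calc R-calc-40
§2 (`ε†d(p)ε = Σ_{m,n} h_mn |sin(p_n∕2)ε′_m − sin(p_m∕2)ε′_n|²`, `h_mn = 1 − g(p_m)g(p_n)Πg(p_λ)`, `g(q) = |L⁻¹Σ_{r<L}e^{iqr}|²`),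
the sign and the GLOBAL quartic bound `≤ ((L²−1)∕12)|p|⁴|ε|²`, and said honestly that the identification «closed form =
Bloch block of the operator» was the calc lane's (three codes), NOT kernel.  THIS FILE PROVES THAT IDENTIFICATION IN KERNEL
FOR THE STRAIGHT-STENCIL AVERAGE — the typed operator `B5Block118.QvOp` = Bałaban's linear average (1.18) of
[Balaban1984PropagatorsI] p. 20 (= the gauge-invariant content of B7's (14): the tree-contour part of (14) is a coarse pure
gauge and drops out of Wilson forms — note §2; that last sentence stays the note's, it is not used here) — against the
tree's own deficit functional `T4AveragingDeficit.deficit A μ ν = n^d Σ_y ‖plaq(Q_kA) μ ν y‖² − n² Σ_x ‖plaq A μ ν x‖²`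
(Federbush's «averaging decreases the action» (0.12): `deficit ≤ 0`, tree `deficit_nonpos`; fourth-order position-space
bound `abs_deficit_le'` with constant `6(d+2)n⁴`).  DICTIONARY: block side `n` (= the note's `L`), fine torus
`Tor (fine n M)`, coarse torus `Tor M`, fine momentum `p′ + l ↔ (k, q)` (`B5Block118.pOf`, a bijection), fine ANGLES
`P_ν := shiftr n k (sOf M q) ν ∕ n` (`angle`; `ω_ν = e^{iP_ν}` = `B5Block118.om`), plane wave `A(x, μ) = ε_μ χ_{p′+l}(x)`
(`planeWave`), twisted polarisation `ε′_κ = e^{−iP_κ∕2}ε_κ` (`twist`, `‖ε′_κ‖ = ‖ε_κ‖`).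

WHAT IS PROVED ([folklore], every dimension `d`, every block side `n ≥ 1`, every coarse torus `Π_μ ℤ∕M_μ`).
§1 `exp_mul_I_sub_one` (`e^{iP} − 1 = 2i sin(P∕2) e^{iP∕2}`), `normSq_sum_exp_pow` (`|Σ_{r<L}e^{iqr}|² = C_L(q)² + S_L(q)²`).
§2 `norm_chi` (`|χ_p(x)| = 1`), `chi_pOf_unitVec` (`χ_{p′+l}(e_μ) = ω_μ`), `plaq_planeWave` (`plaq A x = χ(x)·θ̂_{μν}`,
   `θ̂_{μν} = (ω_μ − 1)ε_ν − (ω_ν − 1)ε_μ` = `plaqAmp`), `sum_normSq_plaq_planeWave` (fine action `= #T_η ‖θ̂‖²`).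
§3 **`normSq_vSym`: `|v_ν(p′+l)|² = g_n(P_ν)`** — part 1's symbol `gSym` IS the squared modulus of B5's block-average
   multiplier (1.31)∕(1.61) (`B5Prop11Fiber.vSym`, via `B5Block118.avg_om`); `sum_chi_spt` (the stencil sum of the character
   factorises: `Σ_{P∈Off}χ(X_y(P)) = χ_{p′}(y)·n^d u·n v_μ·n v_ν`, via `sum_chi_iota`, `avg_om`, `chi_pOf_up`);
   `plaq_QvOp_planeWave` (`plaq(Q_kA)(y) = n θ̂ χ_{p′}(y) u v_μ v_ν`); `normSq_uSym` (`|u|² = Πg_n(P_λ)`);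
   `sum_normSq_plaq_QvOp_planeWave` (coarse action `= #T₁ n² ‖θ̂‖² Πg·g_μ g_ν`).
§4 **`deficit_planeWave`: `deficit (planeWave (p′+l) ε) μ ν = −n^{d+2}·#T₁·‖θ̂_{μν}‖²·h_{μν}(P)`** (`h` = part 1's `hW`);
   `plaqAmp_eq` ∕ **`normSq_plaqAmp`: `‖θ̂_{μν}‖² = 4‖sin(P_ν∕2)ε′_μ − sin(P_μ∕2)ε′_ν‖²`**;
   **`sum_neg_deficit_planeWave`: `Σ_μΣ_ν (−deficit) = 4·n^{d+2}·#T₁·defectFormC n P ε′`** — THE IDENTIFICATION; and the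
   consequence by part 2's `defectFormC_le`: **`sum_neg_deficit_planeWave_le`:
   `Σ_μΣ_ν (−deficit (planeWave (p′+l) ε) μ ν) ≤ 4·n^{d+2}·#T₁·((n²−1)∕12)·(Σ_λP_λ²)²·Σ_κ‖ε_κ‖²`** — the action Bałaban's
   typed average (1.18) loses on a plane wave is fourth order in the fine angles with balaban-calc's sharp constant
   (per unit fine volume `#T_η = n^d #T₁` and in Wilson units this is the note's `C(L)a_c²|p|⁴`); `exists_pOf_eq` (every fine
   momentum is a `p′ + l`).
WHAT IS NOT PROVED HERE.  Anything about B7's non-linear average (15)∕(42) or its tree-contour linearisation (14) beyond the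
straight stencil (the pure-gauge statement of the note); the umklapp (off-diagonal Bloch) blocks; superpositions of plane
waves (the deficit is a quadratic form — its polarisation `T4AveragingDeficit.bil` is in the tree — but no Plancherel
synthesis is done here); the non-abelian defect `𝔇`; anything of NE7.  NOT NE7 (spine 0/9 unchanged), NOT summit
progress.  HONEST DEPENDENCY: continuum YM on T⁴ ⇐ BetaPertH ∧ nine spine estimates (0/9 proved); BetaPertH ⇐ (D1) ∧ (D4) ∧
CAP+tail; G-an2-4 gates asym, D1 and NE2/3/4.

CITATION CONTEXT (no sentence of any paper is a hypothesis): [Balaban1984PropagatorsI] (1.18) p. 20 (the average `Q_k`, typed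
`B5Block118.QvOp`), (1.31) p. 23 ∕ (1.61) p. 28 (its multiplier `u = Πv_ν`, typed `uSym`∕`vSym`, kernel `avg_om`,
`sum_chi_iota`); [Federbush1986PhaseCellI] (0.12) p. 321 (the stability inequality whose deficit is computed, tree
`deficit_nonpos`); [Balaban1985Averaging] (14)∕(48) (orientation only: the operator whose straight part this is).
-/

noncomputable section

open Finset Complex
open scoped BigOperators Matrix ComplexConjugate

namespace Summit.QuantumFields.BalabanUV.T4Continuum.NE7BlockDefectSymbolStencil

open Literature.MathematicalPhysics.QuantumFieldTheory.Balaban1983to89.B4Strip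
open Literature.MathematicalPhysics.QuantumFieldTheory.Balaban1983to89.B5Prop11Fiber
open Literature.MathematicalPhysics.QuantumFieldTheory.Balaban1983to89.B5Prop11Plancherel
open Literature.MathematicalPhysics.QuantumFieldTheory.Balaban1983to89.B5Block118
open Literature.MathematicalPhysics.QuantumFieldTheory.Balaban1983to89.B5AverageCurlStokes
open Literature.MathematicalPhysics.QuantumFieldTheory.Balaban1983to89.T4AveragingDeficit
open Summit.QuantumFields.BalabanUV.T4Continuum.NE7BlockDefectSymbol
open Summit.QuantumFields.BalabanUV.T4Continuum.NE7BlockDefectSymbolBound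

/-! ## §1 Scalar facts: `e^{iP} − 1 = 2i·sin(P∕2)·e^{iP∕2}`, the squared modulus of a geometric sum -/

/-- `e^{iP} − 1 = 2i sin(P∕2) e^{iP∕2}`. [folklore] -/
theorem exp_mul_I_sub_one (P : ℝ) :
    cexp ((P : ℂ) * I) - 1 = 2 * I * ((Real.sin (P / 2) : ℝ) : ℂ) * cexp ((((P / 2 : ℝ)) : ℂ) * I) := by
  rw [Complex.ofReal_sin]
  set z : ℂ := ((P / 2 : ℝ) : ℂ) with hz
  have hP : (P : ℂ) * I = (2 * z) * I := by rw [hz]; push_cast; ring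
  rw [hP, Complex.exp_mul_I, Complex.exp_mul_I, Complex.cos_two_mul, Complex.sin_two_mul]
  have h1 := Complex.sin_sq_add_cos_sq z
  have hI := Complex.I_sq
  linear_combination 2 * h1 - 2 * (Complex.sin z) ^ 2 * hI

/-- `|Σ_{r<L} e^{iqr}|² = C_L(q)² + S_L(q)²` (the part-1 symbol objects). [folklore] -/
theorem normSq_sum_exp_pow (L : ℕ) (q : ℝ) :
    Complex.normSq (∑ r ∈ range L, cexp ((q : ℂ) * I) ^ r) = cSum L q ^ 2 + sSum L q ^ 2 := by
  have hsum : ∑ r ∈ range L, cexp ((q : ℂ) * I) ^ r = ∑ r ∈ range L, cexp ((q * r : ℝ) * I) := by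
    refine Finset.sum_congr rfl fun r _ => ?_
    rw [← Complex.exp_nat_mul]
    congr 1
    push_cast
    ring
  have hre : (∑ r ∈ range L, cexp ((q : ℂ) * I) ^ r).re = cSum L q := by
    rw [hsum, Complex.re_sum]
    unfold cSum
    refine Finset.sum_congr rfl fun r _ => ?_
    rw [Complex.exp_ofReal_mul_I_re]
  have him : (∑ r ∈ range L, cexp ((q : ℂ) * I) ^ r).im = sSum L q := by
    rw [hsum, Complex.im_sum]
    unfold sSum
    refine Finset.sum_congr rfl fun r _ => ?_
    rw [Complex.exp_ofReal_mul_I_im]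
  rw [Complex.normSq_apply, hre, him]; ring

/-! ## §2 The typed torus: plane waves, their plaquette field, the character has modulus one -/

variable {d : ℕ} (n : ℕ) [NeZero n] (M : Fin d → ℕ) [hM : ∀ μ, NeZero (M μ)]

/-- `|χ_p(x)| = 1` on the typed torus. [folklore] -/
theorem norm_chi {N : Fin d → ℕ} [∀ μ, NeZero (N μ)] (p x : Tor N) : ‖chi N p x‖ = 1 := by
  unfold chi
  rw [norm_prod]
  exact Finset.prod_eq_one fun μ _ => AddChar.norm_apply _ _

/-- The PLANE WAVE with fine momentum `p` and polarisation `ε`: `A(x, μ) = ε_μ · χ_p(x)`. [folklore] -/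
def planeWave (p : Tor (fine n M)) (ε : Fin d → ℂ) : Tor (fine n M) × Fin d → ℂ :=
  fun i => ε i.2 * chi (fine n M) p i.1

/-- The fine ANGLE of the momentum `p′ + l ↔ (k, q)` per direction: `P_ν = η(p′_ν + l_ν) = shiftr∕n` (fine spacing 1;
`ω_ν = e^{iP_ν}` is `B5Block118.om`). [folklore] -/
def angle (k : Fin d → Fin n) (q : Tor M) : Fin d → ℝ := fun ν => shiftr n k (sOf M q) ν / n

omit [NeZero n] hM in
/-- `ω_ν = e^{iP_ν}`. [folklore] -/
theorem om_eq_exp_angle (k : Fin d → Fin n) (q : Tor M) (ν : Fin d) :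
    om n k (sOf M q) ν = cexp ((angle n M k q ν : ℂ) * I) := rfl

/-- `χ_{p′+l}(e_μ) = ω_μ`. [folklore] -/
theorem chi_pOf_unitVec (k : Fin d → Fin n) (q : Tor M) (μ : Fin d) :
    chi (fine n M) (pOf n M (k, q)) (unitVec (fine n M) μ) = om n k (sOf M q) μ := by
  have h := chi_pOf_tstep n M k q μ 1
  rw [tstep_succ, tstep_zero, zero_add, pow_one] at h
  exact h

/-- The PLAQUETTE AMPLITUDE of the plane wave: `θ̂_{μν} = (ω_μ − 1)ε_ν − (ω_ν − 1)ε_μ`. [folklore] -/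
def plaqAmp (k : Fin d → Fin n) (q : Tor M) (ε : Fin d → ℂ) (μ ν : Fin d) : ℂ :=
  (om n k (sOf M q) μ - 1) * ε ν - (om n k (sOf M q) ν - 1) * ε μ

/-- `plaq A (x) = χ_p(x) · θ̂_{μν}` for the plane wave. [folklore] -/
theorem plaq_planeWave (k : Fin d → Fin n) (q : Tor M) (ε : Fin d → ℂ) (μ ν : Fin d) (x : Tor (fine n M)) :
    plaq (fine n M) (planeWave n M (pOf n M (k, q)) ε) μ ν x
      = chi (fine n M) (pOf n M (k, q)) x * plaqAmp n M k q ε μ ν := by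
  rw [plaq_apply]
  simp only [planeWave, chi_add_right, chi_pOf_unitVec]
  unfold plaqAmp
  ring

/-- THE FINE ACTION of the plane wave: `Σ_x ‖plaq A‖² = #T_η · ‖θ̂‖²`. [folklore] -/
theorem sum_normSq_plaq_planeWave (k : Fin d → Fin n) (q : Tor M) (ε : Fin d → ℂ) (μ ν : Fin d) :
    ∑ x : Tor (fine n M), ‖plaq (fine n M) (planeWave n M (pOf n M (k, q)) ε) μ ν x‖ ^ 2
      = (Fintype.card (Tor (fine n M)) : ℝ) * ‖plaqAmp n M k q ε μ ν‖ ^ 2 := by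
  simp only [plaq_planeWave, norm_mul, norm_chi, one_mul]
  rw [Finset.sum_const, Finset.card_univ, nsmul_eq_mul]

/-! ## §3 The stencil sum of characters factorises; the coarse plaquette of the plane wave -/

omit hM in
/-- `Z_ν := Σ_{t<n} ω_ν^t = n·v_ν` has `|Z_ν|² = n²·g_n(P_ν)`, i.e. `|v_ν(p′+l)|² = g_n(P_ν)` — the part-1 symbol `gSym`
IS the squared modulus of B5's block-average multiplier (1.31)∕(1.61). [folklore] -/
theorem normSq_vSym (k : Fin d → Fin n) (q : Tor M) (ν : Fin d) :
    Complex.normSq (vSym n k (sOf M q) ν) = gSym n (angle n M k q ν) := by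
  have hn : (n : ℝ) ≠ 0 := by exact_mod_cast NeZero.ne n
  have hnc : (n : ℂ) ≠ 0 := by exact_mod_cast NeZero.ne n
  have havg := avg_om n M k q ν
  have hZ : Complex.normSq (∑ t : Fin n, om n k (sOf M q) ν ^ (t : ℕ))
      = cSum n (angle n M k q ν) ^ 2 + sSum n (angle n M k q ν) ^ 2 := by
    rw [Fin.sum_univ_eq_sum_range (fun t => om n k (sOf M q) ν ^ t) n, om_eq_exp_angle]
    exact normSq_sum_exp_pow n (angle n M k q ν)
  rw [havg, Complex.normSq_mul, Complex.normSq_natCast] at hZ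
  unfold gSym
  rw [← hZ]
  field_simp

/-- The STENCIL SUM of the character factorises:
`Σ_{P∈Off} χ_p(X_y(P)) = χ_{p′}(y) · (n^d u) · (n v_μ) · (n v_ν)`. [folklore] -/
theorem sum_chi_spt (k : Fin d → Fin n) (q : Tor M) (μ ν : Fin d) (y : Tor M) :
    ∑ P : Off d n, chi (fine n M) (pOf n M (k, q)) (spt n M μ ν y P)
      = chi M q y * ((n : ℂ) ^ d * uSym n k (sOf M q))
          * ((n : ℂ) * vSym n k (sOf M q) μ) * ((n : ℂ) * vSym n k (sOf M q) ν) := by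
  rw [← sum_chi_iota n M k q, ← avg_om n M k q μ, ← avg_om n M k q ν, sum_Off]
  simp only [spt_apply, bpt, chi_add_right, chi_pOf_up, chi_pOf_iota, chi_pOf_tstep]
  simp only [← Finset.mul_sum, ← Finset.sum_mul]

/-- THE COARSE PLAQUETTE of the plane wave:
`plaq(Q_kA)(y) = n · θ̂_{μν} · χ_{p′}(y) · u · v_μ · v_ν`. [folklore] -/
theorem plaq_QvOp_planeWave (k : Fin d → Fin n) (q : Tor M) (ε : Fin d → ℂ) (μ ν : Fin d) (y : Tor M) :
    plaq M (QvOp n M *ᵥ planeWave n M (pOf n M (k, q)) ε) μ ν y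
      = (n : ℂ) * plaqAmp n M k q ε μ ν * chi M q y * uSym n k (sOf M q)
          * vSym n k (sOf M q) μ * vSym n k (sOf M q) ν := by
  have hnc : (n : ℂ) ≠ 0 := by exact_mod_cast NeZero.ne n
  rw [plaq_QvOp_spt]
  simp only [plaq_planeWave]
  rw [← Finset.sum_mul, sum_chi_spt]
  field_simp
  ring

omit hM in
/-- `|u|² = Π_λ g_n(P_λ)`. [folklore] -/
theorem normSq_uSym (k : Fin d → Fin n) (q : Tor M) :
    Complex.normSq (uSym n k (sOf M q)) = ∏ l, gSym n (angle n M k q l) := by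
  unfold uSym
  rw [map_prod]
  exact Finset.prod_congr rfl fun l _ => normSq_vSym n M k q l

/-- THE COARSE ACTION of the plane wave: `Σ_y ‖plaq(Q_kA)(y)‖² = #T₁ · n² ‖θ̂‖² · Πg · g_μ · g_ν`. [folklore] -/
theorem sum_normSq_plaq_QvOp_planeWave (k : Fin d → Fin n) (q : Tor M) (ε : Fin d → ℂ) (μ ν : Fin d) :
    ∑ y : Tor M, ‖plaq M (QvOp n M *ᵥ planeWave n M (pOf n M (k, q)) ε) μ ν y‖ ^ 2
      = (Fintype.card (Tor M) : ℝ) * ((n : ℝ) ^ 2 * ‖plaqAmp n M k q ε μ ν‖ ^ 2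
          * (∏ l, gSym n (angle n M k q l)) * gSym n (angle n M k q μ) * gSym n (angle n M k q ν)) := by
  have hpt : ∀ y : Tor M, ‖plaq M (QvOp n M *ᵥ planeWave n M (pOf n M (k, q)) ε) μ ν y‖ ^ 2
      = (n : ℝ) ^ 2 * ‖plaqAmp n M k q ε μ ν‖ ^ 2
          * (∏ l, gSym n (angle n M k q l)) * gSym n (angle n M k q μ) * gSym n (angle n M k q ν) := by
    intro y
    rw [plaq_QvOp_planeWave]
    simp only [norm_mul, norm_chi, Complex.norm_natCast, mul_one, mul_pow]
    rw [Complex.sq_norm (uSym n k (sOf M q)), Complex.sq_norm (vSym n k (sOf M q) μ),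
      Complex.sq_norm (vSym n k (sOf M q) ν), normSq_uSym, normSq_vSym, normSq_vSym]
  simp only [hpt]
  rw [Finset.sum_const, Finset.card_univ, nsmul_eq_mul]

/-! ## §4 THE IDENTIFICATION: Federbush's deficit of `Q_k` on a plane wave IS the closed-form defect -/

/-- **THE DEFICIT OF A PLANE WAVE (per plane).**  For Bałaban's linear block average `Q_k` = `B5Block118.QvOp` (B5 (1.18))
and `T4AveragingDeficit.deficit A μ ν = n^d Σ_y ‖plaq(Q_kA)‖² − n² Σ_x ‖plaq A‖²`:
`deficit (planeWave (p′+l) ε) μ ν = −n^{d+2} · #T₁ · ‖θ̂_{μν}‖² · h_{μν}(P)`, `h` = part 1's weight `hW`,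
`P = angle` the fine angles of `p′ + l`. [folklore] -/
theorem deficit_planeWave (k : Fin d → Fin n) (q : Tor M) (ε : Fin d → ℂ) (μ ν : Fin d) :
    deficit n M (planeWave n M (pOf n M (k, q)) ε) μ ν
      = -((n : ℝ) ^ (d + 2) * Fintype.card (Tor M)) * ‖plaqAmp n M k q ε μ ν‖ ^ 2
          * hW n (angle n M k q) μ ν := by
  unfold deficit
  rw [sum_normSq_plaq_QvOp_planeWave, sum_normSq_plaq_planeWave, card_fine]
  unfold hW
  ring

/-- The TWISTED polarisation `ε′_κ = e^{−iP_κ∕2} ε_κ` (the note's `ε′_m = e^{−ip_m∕2}ε_m`; `|ε′_κ| = |ε_κ|`). [folklore] -/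
def twist (P : Fin d → ℝ) (ε : Fin d → ℂ) : Fin d → ℂ := fun κ => cexp (-(((P κ / 2 : ℝ)) : ℂ) * I) * ε κ

omit [NeZero n] hM in
/-- `‖ε′_κ‖ = ‖ε_κ‖`. [folklore] -/
theorem norm_twist (P : Fin d → ℝ) (ε : Fin d → ℂ) (κ : Fin d) : ‖twist P ε κ‖ = ‖ε κ‖ := by
  unfold twist
  rw [norm_mul, show -(((P κ / 2 : ℝ)) : ℂ) * I = ((-(P κ / 2) : ℝ) : ℂ) * I by push_cast; ring,
    Complex.norm_exp_ofReal_mul_I, one_mul]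

omit [NeZero n] hM in
/-- THE AMPLITUDE IN THE NOTE'S FORM: `θ̂_{μν} = 2i e^{i(P_μ+P_ν)∕2} (sin(P_μ∕2) ε′_ν − sin(P_ν∕2) ε′_μ)`. [folklore] -/
theorem plaqAmp_eq (k : Fin d → Fin n) (q : Tor M) (ε : Fin d → ℂ) (μ ν : Fin d) :
    plaqAmp n M k q ε μ ν
      = 2 * I * cexp ((((angle n M k q μ / 2 + angle n M k q ν / 2 : ℝ)) : ℂ) * I)
          * (((Real.sin (angle n M k q μ / 2) : ℝ) : ℂ) * twist (angle n M k q) ε ν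
              - ((Real.sin (angle n M k q ν / 2) : ℝ) : ℂ) * twist (angle n M k q) ε μ) := by
  unfold plaqAmp twist
  rw [om_eq_exp_angle, om_eq_exp_angle, exp_mul_I_sub_one, exp_mul_I_sub_one]
  set a : ℂ := cexp ((((angle n M k q μ / 2 : ℝ)) : ℂ) * I) with ha
  set b : ℂ := cexp ((((angle n M k q ν / 2 : ℝ)) : ℂ) * I) with hb
  have ha' : cexp (-(((angle n M k q μ / 2 : ℝ)) : ℂ) * I) = a⁻¹ := by
    rw [ha, ← Complex.exp_neg]; ring_nf
  have hb' : cexp (-(((angle n M k q ν / 2 : ℝ)) : ℂ) * I) = b⁻¹ := by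
    rw [hb, ← Complex.exp_neg]; ring_nf
  have hab : cexp ((((angle n M k q μ / 2 + angle n M k q ν / 2 : ℝ)) : ℂ) * I) = a * b := by
    rw [ha, hb, ← Complex.exp_add]; push_cast; ring_nf
  rw [ha', hb', hab]
  have ha0 : a ≠ 0 := Complex.exp_ne_zero _
  have hb0 : b ≠ 0 := Complex.exp_ne_zero _
  field_simp

omit [NeZero n] hM in
/-- `‖θ̂_{μν}‖² = 4 ‖sin(P_ν∕2) ε′_μ − sin(P_μ∕2) ε′_ν‖²`. [folklore] -/
theorem normSq_plaqAmp (k : Fin d → Fin n) (q : Tor M) (ε : Fin d → ℂ) (μ ν : Fin d) :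
    ‖plaqAmp n M k q ε μ ν‖ ^ 2
      = 4 * ‖((Real.sin (angle n M k q ν / 2) : ℝ) : ℂ) * twist (angle n M k q) ε μ
              - ((Real.sin (angle n M k q μ / 2) : ℝ) : ℂ) * twist (angle n M k q) ε ν‖ ^ 2 := by
  rw [plaqAmp_eq, norm_mul, norm_mul, norm_mul, Complex.norm_exp_ofReal_mul_I, Complex.norm_I,
    Complex.norm_two, ← norm_neg (((Real.sin (angle n M k q ν / 2) : ℝ) : ℂ) * twist (angle n M k q) ε μ
      - ((Real.sin (angle n M k q μ / 2) : ℝ) : ℂ) * twist (angle n M k q) ε ν), neg_sub]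
  ring

/-- **H-1′ — THE IDENTIFICATION (summed over ordered planes).**  For every fine momentum `p′ + l ↔ (k, q)` and every
polarisation `ε`:  `Σ_μ Σ_ν (−deficit (planeWave (p′+l) ε) μ ν) = 4 · n^{d+2} · #T₁ · defectFormC n P ε′` — Federbush's
one-step action deficit of the TYPED average `Q_k` on a plane wave is, plane by plane and exactly, the closed-form
diagonal Bloch defect of parts 1–2 (balaban-calc R-calc-40 §2) at the fine angles `P` with the twisted polarisation
`ε′`. [folklore] -/
theorem sum_neg_deficit_planeWave (k : Fin d → Fin n) (q : Tor M) (ε : Fin d → ℂ) :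
    ∑ μ, ∑ ν, -deficit n M (planeWave n M (pOf n M (k, q)) ε) μ ν
      = 4 * ((n : ℝ) ^ (d + 2) * Fintype.card (Tor M))
          * defectFormC n (angle n M k q) (twist (angle n M k q) ε) := by
  unfold defectFormC
  rw [Finset.mul_sum]
  refine Finset.sum_congr rfl fun μ _ => ?_
  rw [Finset.mul_sum]
  refine Finset.sum_congr rfl fun ν _ => ?_
  rw [deficit_planeWave, normSq_plaqAmp]
  ring

/-- **H-1′ — THE SHARP QUARTIC BOUND FOR THE TYPED OPERATOR.**  For `n ≥ 1` (automatic: `NeZero n`), every fine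
momentum and polarisation:
`Σ_μ Σ_ν (−deficit (planeWave (p′+l) ε) μ ν) ≤ 4·n^{d+2}·#T₁ · ((n²−1)∕12) · (Σ_λ P_λ²)² · Σ_κ ‖ε_κ‖²`
— the action Bałaban's linear average (1.18) loses on a plane wave is FOURTH ORDER in the fine angles with balaban-calc's
sharp constant, by `NE7BlockDefectSymbolBound.defectFormC_le`; and it is `≥ 0` plane by plane (Federbush ∕
`deficit_nonpos`). [folklore] -/
theorem sum_neg_deficit_planeWave_le (k : Fin d → Fin n) (q : Tor M) (ε : Fin d → ℂ) :
    ∑ μ, ∑ ν, -deficit n M (planeWave n M (pOf n M (k, q)) ε) μ ν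
      ≤ 4 * ((n : ℝ) ^ (d + 2) * Fintype.card (Tor M))
          * (((n : ℝ) ^ 2 - 1) / 12 * (∑ l, angle n M k q l ^ 2) ^ 2 * ∑ κ, ‖ε κ‖ ^ 2) := by
  rw [sum_neg_deficit_planeWave]
  have hn : 1 ≤ n := Nat.one_le_iff_ne_zero.mpr (NeZero.ne n)
  have h := defectFormC_le hn (angle n M k q) (twist (angle n M k q) ε)
  simp only [norm_twist] at h
  have hc : (0 : ℝ) ≤ 4 * ((n : ℝ) ^ (d + 2) * Fintype.card (Tor M)) := by positivity
  exact mul_le_mul_of_nonneg_left h hc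

/-- Every fine momentum is of the form `p′ + l`: the statements above cover ALL plane waves of the fine torus
(`B5Block118.pOf_bijective`). [folklore] -/
theorem exists_pOf_eq (p : Tor (fine n M)) : ∃ kq : (Fin d → Fin n) × Tor M, pOf n M kq = p :=
  (pOf_bijective n M).2 p

end Summit.QuantumFields.BalabanUV.T4Continuum.NE7BlockDefectSymbolStencil

end
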